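import Mathlib
import Summits.Langlands.Langlands.Theorems.IrreducibilityBySelfDualityIrreducibleOffSectorLanglandsOfReciprocity
import Summits.Langlands.Langlands.Theorems.IrreducibilityBySelfDualityReciprocityUpToIrreducibilityIsobaricRigidity
import Summits.Langlands.Langlands.Theorems.IrreducibilityBySelfDualityReciprocityUpToIrreducibilityDeRhamBlocks
import Summits.Langlands.Langlands.Theorems.IrreducibilityBySelfDualityReciprocityUpToIrreducibilityGeometricConstituents
import Literature.NumberTheory.Automorphic.IsAutomorphicAE
import Literature.NumberTheory.Automorphic.GLnAdelicStructureProofs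
import HarnessLib

/-!
# `CapacityClassicality.SectorToLanglands` (item stmt-Langlands-10368) from its five leaves — STRUCTURAL glue
(crux-strategist planner-cstrat-stmt-Langlands-10368-r1-0, 2026-08-17; `--supports stmt-Langlands-10368`;
imports `Summits.Langlands.Statement` + landed Theses-free modules + Literature only — NO `Theses` module — so that
`route edit --split SectorToLanglands … --glue-by` can link it from the route file without an import cycle,
IrreducibilityBySelfDuality kill criterion (e)).

The deciding crux `SectorToLanglands := EigenIntegralOverconvergentIsClassical → Langlands` of route
`CapacityClassicality` is the summit modulo its antecedent β′ (refuter certificate `iff_or`, Evidence10368.lean;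
re-audit bin RESTATED, 2026-08-16).  BC2 REDIRECT: this file proves, sorry-free, the typed decomposition

  `W → B_w → LGC → AC (2.2) → AC (2.3) → SectorToLanglands`          (`sectorToLanglands_of_leaves`)

with the five leaves stated VERBATIM as the texts of the route's new children `WeakExistence` (W: Buzzard–Gee
Conj. 3.2.2, weak form — some pinned-geometric avatar, Satake–Frobenius compatible a.e.), `WeakAutomorphy`
(B_w: Fontaine–Mazur–Langlands, a.e. form), `PairCompatibility` (LGC: Taylor 2004 Conj. 7 for irreducible
pinned-geometric a.e.-compatible pairs, the only clause carrying `∃ Rec`), `PairLBoundaryJS` (Arthur–Clozel Ch. 3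
(2.2) for Borel–Jacquet data = item stmt-Langlands-13622 verbatim = the named fact
`JacquetShalika1981_partialPairL_boundary_repData`, δ-equal) and `PairLPoleJS` (Arthur–Clozel (2.3) = the named fact
`JacquetShalika1981_partialPairL_pole_repData` with `partialPairL` unfolded, δ-equal), and the conclusion stated as
the text of `SectorToLanglands` (β′-text `→ _root_.Langlands`).

MATHEMATICAL CONTENT OF THE SEAM (why this is not a one-line seam).  (i) Direction (A): W gives a pinned-geometric
avatar `ρ` of a cuspidal L-algebraic `π`; `ρ` is IRREDUCIBLE by the isobaric bootstrap — its irreducible geometric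
constituents (`stub_geometricConstituents` p99702 with de Rham heredity `stub_deRhamBlocks` p98936) are cuspidal
automorphic by B_w, and Jacquet–Shalika rigidity (`stub_isobaricRigidity` p105601 ⟸ (2.2), (2.3)) forbids `k ≥ 2`
of them; then LGC.  (ii) Direction (B): B_w then LGC.  (iii) Irreducibility of EVERY corresponding `ρ'` and
uniqueness up to conjugacy (Chebotarev + Brauer–Nesbitt) are the landed structural theorem
`IrreducibleOffSector.langlands_of_reciprocityUpToIrreducibility_text_of_JS` (landed:
`Theorems/IrreducibilityBySelfDualityIrreducibleOffSectorLanglandsOfReciprocity.lean`, sibling crux stmt-Langlands-14329).  Steps (i)–(ii) re-elaborate, on the texts, the landed decoupling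
`ReciprocityUpToIrreducibility.reciprocityUpToIrreducibility_of_weak` (p116715, crux stmt-Langlands-14328, line
`Sketch`), whose module imports the IrreducibilityBySelfDuality Theses file and therefore cannot be imported here.
(iv) The antecedent β′ of `SectorToLanglands` is NOT used: no typed assembly toward `Langlands` can consume a
`GL₂/ℚ` q-expansion classicality statement (planner census STRATEGY-CENSUS.md on the item) — the decomposition is one
of `Langlands` itself, reached by these five strictly weaker leaves, followed by weakening.

No definitions; axioms `propext`, `Classical.choice`, `Quot.sound`.

References: K. Buzzard, T. Gee, LMS LNS 414 (2014), Conj. 3.2.1–3.2.2 [BuzzardGeeLMS2014]; J.-M. Fontaine,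
B. Mazur (1995), Conj. 1 [FontaineMazurGeometric1995]; J. Arthur, L. Clozel, Ann. Math. Stud. 120, Ch. 3 §2
(2.2)–(2.3) [ArthurClozelAMS120]; H. Jacquet, J. Shalika, AJM 103 (1981) I Thm. 5.3, II Prop. 3.6 / Thm. 4.4
[JacquetShalikaAJM1981, JacquetShalikaAJM1981II]; F. Calegari, T. Gee, Ann. Inst. Fourier 63 (2013) §1.1
[CalegariGee2013]; P. Deligne, J.-P. Serre, ASENS 7 (1974), Lemme 3.2 [DeligneSerreASENS1974].
-/

noncomputable section

set_option linter.dupNamespace false -- project-wide option; `Summit.Langlands.Langlands` is the mandated namespace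

open scoped NumberField Classical Polynomial Topology
open Filter IsDedekindDomain Polynomial
open Literature.NumberTheory.Automorphic Literature.NumberTheory.GaloisRepresentations
open Summit.Langlands
open Summit.Langlands.Langlands.Theorems.ReciprocityUpToIrreducibility

namespace Summit.Langlands.Langlands.Theorems.CapacityClassicalitySectorToLanglands

/-- **`SectorToLanglands` from its five leaves W, B_w, LGC, AC (2.2), AC (2.3)** (texts verbatim; the β′
antecedent of the conclusion is discarded — see the module docstring, (iv)).  Proof: the isobaric bootstrap run
with B_w (irreducibility of the pinned-geometric avatar of a cuspidal `π`), then the packaging of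
reciprocity-up-to-irreducibility for the `Rec` of LGC, then the landed structural
`langlands_of_reciprocityUpToIrreducibility_text_of_JS` (irreducibility of every avatar + Chebotarev–Brauer–Nesbitt
uniqueness). [cite: BuzzardGeeLMS2014, Conj. 3.2.1 and Conj. 3.2.2] [cite: ArthurClozelAMS120, Ch. 3 §2 (2.2)–(2.3)]
[cite: CalegariGee2013, §1.1] [cite: DeligneSerreASENS1974, Lemme 3.2] -/
theorem sectorToLanglands_of_leaves :
    (∀ (K : Type) [Field K] [NumberField K] (n : ℕ) (hcpt : isCompact_glFiniteIntegralLevel n K),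
      0 < n → ∀ π : CuspidalAutomorphicRepData n K hcpt, π.1.IsLAlgebraic → ∀ (ℓ : ℕ) [Fact
      ℓ.Prime] (ι : PadicAlgCl ℓ ≃+* ℂ), ∃ ρ : FramedGaloisRep K (PadicAlgCl ℓ) n, ((∀ᶠ v :
      HeightOneSpectrum (𝓞 K) in cofinite, ρ.IsUnramifiedAt v) ∧ ∀ (v : HeightOneSpectrum (𝓞 K))
      (hv : ((ℓ : ℕ) : 𝓞 K) ∈ v.asIdeal),
      (Literature.NumberTheory.PAdicHodge.fontainePstAdicCompletion v ℓ hv).IsDeRhamFramed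
      (ρ.toLocal v)) ∧ ∀ᶠ v : HeightOneSpectrum (𝓞 K) in cofinite, SatakeFrobCompatibleAt ι π.1 ρ v) →
    (∀ (K : Type) [Field K] [NumberField K] (n : ℕ) (hcpt : isCompact_glFiniteIntegralLevel n K),
      0 < n → ∀ (ℓ : ℕ) [Fact ℓ.Prime] (ι : PadicAlgCl ℓ ≃+* ℂ) (ρ : FramedGaloisRep K (PadicAlgCl
      ℓ) n), ρ.toGaloisRep.IsIrreducible → ((∀ᶠ v : HeightOneSpectrum (𝓞 K) in cofinite,
      ρ.IsUnramifiedAt v) ∧ ∀ (v : HeightOneSpectrum (𝓞 K)) (hv : ((ℓ : ℕ) : 𝓞 K) ∈ v.asIdeal),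
      (Literature.NumberTheory.PAdicHodge.fontainePstAdicCompletion v ℓ hv).IsDeRhamFramed
      (ρ.toLocal v)) → ∃ π : CuspidalAutomorphicRepData n K hcpt, π.1.IsLAlgebraic ∧ ∀ᶠ v :
      HeightOneSpectrum (𝓞 K) in cofinite, SatakeFrobCompatibleAt ι π.1 ρ v) →
    (∀ (K : Type) [Field K] [NumberField K], ∃ Rec : ReciprocityData K, ∀ (n : ℕ) (hcpt :
      isCompact_glFiniteIntegralLevel n K), 0 < n → ∀ (π : CuspidalAutomorphicRepData n K hcpt),
      π.1.IsLAlgebraic → ∀ (ℓ : ℕ) [Fact ℓ.Prime] (ι : PadicAlgCl ℓ ≃+* ℂ) (ρ : FramedGaloisRep K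
      (PadicAlgCl ℓ) n), ρ.toGaloisRep.IsIrreducible → ((∀ᶠ v : HeightOneSpectrum (𝓞 K) in
      cofinite, ρ.IsUnramifiedAt v) ∧ ∀ (v : HeightOneSpectrum (𝓞 K)) (hv : ((ℓ : ℕ) : 𝓞 K) ∈
      v.asIdeal), (Literature.NumberTheory.PAdicHodge.fontainePstAdicCompletion v ℓ
      hv).IsDeRhamFramed (ρ.toLocal v)) → (∀ᶠ v : HeightOneSpectrum (𝓞 K) in cofinite,
      SatakeFrobCompatibleAt ι π.1 ρ v) → ∀ v : HeightOneSpectrum (𝓞 K), LocalGlobalCompatibleAt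
      Rec ι π.1 ρ v) →
    (∀ (n m : ℕ) (F : Type) [Field F] [NumberField F] (hF : _) (hF' : _), 0 < n → 0 < m → ∀ (π :
      CuspidalAutomorphicRepData n F hF) (π' : CuspidalAutomorphicRepData m F hF'), ∃ S₀ : Set
      (HeightOneSpectrum (𝓞 F)), S₀.Finite ∧ ∀ {S : Set (HeightOneSpectrum (𝓞 F))}, S.Finite → S₀ ⊆
      S → ∀ {α β : HeightOneSpectrum (𝓞 F) → Multiset ℂ}, (∀ w ∉ S, π.1.HasSatakeParamAt w (α w)) →
      (∀ w ∉ S, π'.1.HasSatakeParamAt w (β w)) → (∀ w ∉ S, ‖(α w).prod‖ = 1) → (∀ w ∉ S, ‖(β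
      w).prod‖ = 1) → ∀ {s₀ : ℂ}, s₀.re = 1 → ¬ (n = m ∧ ∀ᶠ w in cofinite, (α w).map
      ((((w.residueCard : ℂ) ^ (1 - s₀))) * ·) = (β w).map (·⁻¹)) → ∃ c : ℂ, c ≠ 0 ∧ Tendsto (fun s
      : ℂ => ∏' w : {w : HeightOneSpectrum (𝓞 F) // w ∉ S}, ((satakePairPolynomial (α w.1) (β
      w.1)).eval ((w.1.residueCard : ℂ) ^ (-s)))⁻¹) (𝓝[{s : ℂ | 1 < s.re}] s₀) (𝓝 c)) →
    (∀ (n : ℕ) (F : Type) [Field F] [NumberField F] (hF : _), 0 < n → ∀ (π π' :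
      CuspidalAutomorphicRepData n F hF), ∃ S₀ : Set (HeightOneSpectrum (𝓞 F)), S₀.Finite ∧ ∀ {S :
      Set (HeightOneSpectrum (𝓞 F))}, S.Finite → S₀ ⊆ S → ∀ {α β : HeightOneSpectrum (𝓞 F) →
      Multiset ℂ}, (∀ w ∉ S, π.1.HasSatakeParamAt w (α w)) → (∀ w ∉ S, π'.1.HasSatakeParamAt w (β
      w)) → (∀ w ∉ S, ‖(α w).prod‖ = 1) → (∀ w ∉ S, ‖(β w).prod‖ = 1) → ∀ {s₀ : ℂ}, s₀.re = 1 → (∀ᶠ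
      w in cofinite, (α w).map ((((w.residueCard : ℂ) ^ (1 - s₀))) * ·) = (β w).map (·⁻¹)) → ∃ c :
      ℂ, c ≠ 0 ∧ Tendsto (fun s : ℂ => (s - s₀) * ∏' w : {w : HeightOneSpectrum (𝓞 F) // w ∉ S},
      ((satakePairPolynomial (α w.1) (β w.1)).eval ((w.1.residueCard : ℂ) ^ (-s)))⁻¹) (𝓝[{s : ℂ | 1
      < s.re}] s₀) (𝓝 c)) →
    ((∀ (p : ℕ) [Fact p.Prime] (hp : 5 ≤ p) (N : ℕ) [NeZero N], ¬ p ∣ N → ∀ (k : ℤ) (ι :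
        PadicAlgCl p ≃+* ℂ) (E : Type) [Field E] [NumberField E] (σ₀ : E →+* ℂ) (a : ℕ → E) (ψ :
        DirichletCharacter ℂ N), a 1 = 1 → (∀ n, IsIntegral ℤ (a n)) → (∀ (σ : E →+* ℂ) (t : ℝ), 0
        < t → t < 1 → ∃ C : ℝ, ∀ n, ‖σ (a n)‖ * t ^ n ≤ C) → (∃ (r C : ℝ) (c : ℕ → PowerSeries ℂ),
        0 < r ∧ (∀ i : ℕ, ∃ F : ModularForm (CongruenceSubgroup.Gamma1 N) (k + i * (p - 1 : ℕ)), c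
        i = UpperHalfPlane.qExpansion 1 ⇑F) ∧ (∀ i n : ℕ, ‖ι.symm (PowerSeries.coeff n (c i))‖ ≤ C
        * (p : ℝ) ^ (-(r * i))) ∧ ∀ n : ℕ, HasSum (fun i : ℕ ↦ ι.symm (PowerSeries.coeff n (c i *
        ((UpperHalfPlane.qExpansion 1 ⇑(ModularForm.E (show 3 ≤ p - 1 by omega)))⁻¹) ^ i))) (ι.symm
        (σ₀ (a n)))) → (∀ ℓ n : ℕ, ℓ.Prime → ¬ ℓ ∣ N * p → 0 < n → σ₀ (a (ℓ * n)) + (if ℓ ∣ n then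
        ψ ℓ * (ℓ : ℂ) ^ (k - 1) * σ₀ (a (n / ℓ)) else 0) = σ₀ (a ℓ) * σ₀ (a n)) → ∃ (M : ℕ) (_ :
        NeZero M) (G : ModularForm (CongruenceSubgroup.Gamma1 M) k), UpperHalfPlane.qExpansion 1 ⇑G
        = PowerSeries.mk (fun n ↦ σ₀ (a n))) →
      _root_.Langlands) := by
  intro hW hB hL hJSb hJSp _hβ
  -- the isobaric bootstrap, run with B_w: a pinned-geometric avatar of a cuspidal `π` is irreducible
  have irr : ∀ (K : Type) [Field K] [NumberField K] (n : ℕ) (hcpt : isCompact_glFiniteIntegralLevel n K)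
      (_ : 0 < n) (π : CuspidalAutomorphicRepData n K hcpt) (ℓ : ℕ) [Fact ℓ.Prime]
      (ι : PadicAlgCl ℓ ≃+* ℂ) (ρ : FramedGaloisRep K (PadicAlgCl ℓ) n),
      ((∀ᶠ v : HeightOneSpectrum (𝓞 K) in cofinite, ρ.IsUnramifiedAt v) ∧
        ∀ (v : HeightOneSpectrum (𝓞 K)) (hv : ((ℓ : ℕ) : 𝓞 K) ∈ v.asIdeal),
          (Literature.NumberTheory.PAdicHodge.fontainePstAdicCompletion v ℓ hv).IsDeRhamFramed
            (ρ.toLocal v)) →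
      (∀ᶠ v : HeightOneSpectrum (𝓞 K) in cofinite, SatakeFrobCompatibleAt ι π.1 ρ v) →
        ρ.toGaloisRep.IsIrreducible := by
    intro K _ _ n hcpt hn π ℓ _ ι ρ hgeo hρ
    obtain ⟨k, m, r, hr, hchar, -, hone⟩ :=
      stub_geometricConstituents stub_deRhamBlocks K ℓ n ρ hn hgeo
    by_cases hk1 : k = 1
    · exact hone hk1
    have hk0 : k ≠ 0 := by
      rintro rfl
      have h1 := hchar 1
      simp only [Finset.univ_eq_empty, Finset.prod_empty] at h1
      have hdeg : (FramedRep.charpoly ρ 1).natDegree = n := by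
        simp [FramedRep.charpoly, Matrix.charpoly_natDegree_eq_dim]
      rw [h1, natDegree_one] at hdeg
      omega
    have hk2 : 2 ≤ k := by omega
    have hσ : ∀ i, ∃ σ : CuspidalAutomorphicRepData (m i) K
        (isCompact_glFiniteIntegralLevel_holds (m i) K),
        ∀ᶠ v : HeightOneSpectrum (𝓞 K) in cofinite, SatakeFrobCompatibleAt ι σ.1 (r i) v := by
      intro i
      obtain ⟨σ, -, hcorr⟩ := hB K (m i) (isCompact_glFiniteIntegralLevel_holds (m i) K) (hr i).1 ℓ ι
        (r i) (hr i).2.1 (hr i).2.2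
      exact ⟨σ, hcorr⟩
    choose σ hσc using hσ
    refine (stub_isobaricRigidity hJSb hJSp K n hcpt π k m
      (fun i => isCompact_glFiniteIntegralLevel_holds (m i) K) σ hn hk2 (fun i => (hr i).1) ?_).elim
    have hall : ∀ᶠ v : HeightOneSpectrum (𝓞 K) in cofinite,
        ∀ i, SatakeFrobCompatibleAt ι (σ i).1 (r i) v :=
      Filter.eventually_all.mpr hσc
    filter_upwards [hρ, hall] with v hv hvi
    intro α hα
    obtain ⟨α₀, hα₀, -, hcp⟩ := hv
    obtain rfl : α = α₀ := AutomorphicRepData.hasSatakeParamAt_unique_holds π.1 hα hα₀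
    choose β hβ _hurβ hcpβ using hvi
    refine ⟨β, hβ, ?_⟩
    have hprod : ρ.HasFrobCharpolyAt v (∏ i, arithFrobPolyOfSatake ι v.residueCard 1 (β i)) := by
      intro 𝔓 h𝔓 τ hτ
      rw [hchar τ]
      exact Finset.prod_congr rfl fun i _ => hcpβ i 𝔓 h𝔓 τ hτ
    rw [← Summit.Langlands.Langlands.Theorems.IrreducibleOffSector.arithFrobPolyOfSatake_sum] at hprod
    have heq : arithFrobPolyOfSatake ι v.residueCard 1 α =
        arithFrobPolyOfSatake ι v.residueCard 1 (∑ i, β i) :=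
      GaloisRep.HasFrobCharpolyAt.unique_holds
        ((FramedGaloisRep.hasFrobCharpolyAt_toGaloisRep_iff v _ ρ).mpr hcp)
        ((FramedGaloisRep.hasFrobCharpolyAt_toGaloisRep_iff v _ ρ).mpr hprod)
    exact arithFrobPolyOfSatake_one_injective ι _ heq
  -- reciprocity up to irreducibility (the text of crux stmt-Langlands-14328) for the `Rec` of LGC
  have hE : ∀ (F : Type) [Field F] [NumberField F], ∃ Rec : ReciprocityData F, ∀ n : ℕ, 0 < n →
      ∀ hcpt : isCompact_glFiniteIntegralLevel n F,
        (∀ π : CuspidalAutomorphicRepData n F hcpt, π.1.IsLAlgebraic →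
          ∀ (ℓ : ℕ) [Fact ℓ.Prime] (ι : PadicAlgCl ℓ ≃+* ℂ),
            ∃ ρ : FramedGaloisRep F (PadicAlgCl ℓ) n, IsGeometricFramed Rec ρ ∧ Corresponds Rec ι π.1 ρ) ∧
        GaloisToAutomorphic n Rec hcpt := by
    intro F _ _
    obtain ⟨Rec, hRec⟩ := hL F
    refine ⟨Rec, fun n hn hcpt => ⟨fun π hLalg ℓ _ ι => ?_, fun ℓ _ ι ρ hirr hgeo => ?_⟩⟩
    · obtain ⟨ρ, hgeo, hρ⟩ := hW F n hcpt hn π hLalg ℓ ι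
      have hirr : ρ.toGaloisRep.IsIrreducible := irr F n hcpt hn π ℓ ι ρ hgeo hρ
      exact ⟨ρ, hgeo, hρ, hRec n hcpt hn π hLalg ℓ ι ρ hirr hgeo hρ⟩
    · obtain ⟨π, hLalg, hρ⟩ := hB F n hcpt hn ℓ ι ρ hirr hgeo
      exact ⟨π, hLalg, hρ, hRec n hcpt hn π hLalg ℓ ι ρ hirr hgeo hρ⟩
  -- the summit: irreducibility of every avatar and Chebotarev–Brauer–Nesbitt uniqueness (landed, structural)
  exact Summit.Langlands.Langlands.Theorems.IrreducibleOffSector.langlands_of_reciprocityUpToIrreducibility_text_of_JS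
    hJSb hJSp hE

end Summit.Langlands.Langlands.Theorems.CapacityClassicalitySectorToLanglands

end
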